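import Mathlib
import HarnessLib

/-!
# Trilinear forms with Kloosterman fractions: bookkeeping for the diagonal bound (Bettin–Chandee §3, (3.5))

Topic `NumberTheory/LFunctions`.  S. Bettin, V. Chandee, *Trilinear forms with Kloosterman
fractions*, Adv. Math. 328 (2018), §3, (3.5):
`𝒟_b ≪ ‖β‖²‖ν‖² L (A(bLN)^{1/2} + AM/(bN) + M) M^ε`.
This file PROVES the elementary real-variable inequalities that turn the explicit inner bound of
`TrilinearKloostermanFractionsDiagInner.lean` (with divisor functions, `log`, and the twist factor
`Tw = 1 + 8π|η|A/(bN'M)`) into the shape (3.5) with `((1+|ϑ|+|η|)bMN'A)^ε` and the factor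
`W = 1 + (|ϑ|+|η|)A/(bN'M)` of Remark 2:

* `BC_diag_twist_le` — `Tw ≤ 26 W`;
* `BC_diag_log_le` — `1 + log(8bN'²) ≤ (1 + 1/δ) 2^δ y^δ` for `8bN'² ≤ 2y`, `y ≥ 1`;
* `BC_diag_count_le` — `∑_{n₂ ∈ T} [ℓ₁n₁ = ℓ₂n₂] R ≤ [ℓ₂ ∣ ℓ₁n₁] R` (`R ≥ 0`, `ℓ₂ ≥ 1`);
* **`BC_diag_bookkeeping`** —
  `(1+t₁)(2M + t₂² Tw (32(2M+1)A/(bN') + 16 A SQ Lg)) ≤ 13312 C³ (1+1/δ) 2^δ y^{4δ} W (A SQ + AM/(bN') + M)`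
  under `tᵢ ≤ C y^δ`, `Tw ≤ 26W`, `Lg ≤ (1+1/δ)2^δ y^δ`, `M ≥ 1/2`, `y, C, W ≥ 1`.

No new named facts (D-0026).

## References

* S. Bettin, V. Chandee, Adv. Math. 328 (2018) 1234–1262 (arXiv:1502.00769), §3 (3.5), Remark 2.
  [BettinChandee2018]
-/

noncomputable section

open Finset Real

namespace Literature.NumberTheory.LFunctions

/-- **The twist factor against `W`**: `1 + 2π(|η|(4A/(bN')))/M ≤ 26 (1 + (|ϑ|+|η|)A/(bN'M))`.
[cite: BettinChandee2018, Remark 2] -/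
theorem BC_diag_twist_le (ϑ : ℤ) (η : ℝ) {A b N' M : ℝ} (hA : 0 ≤ A) (hb : 0 < b) (hN' : 0 < N')
    (hM : 0 < M) :
    1 + 2 * Real.pi * (|η| * (4 * A / (b * N'))) / M ≤
      26 * (1 + (|(ϑ : ℝ)| + |η|) * A / (b * N' * M)) := by
  have hπ : Real.pi < 3.15 := Real.pi_lt_d2
  have hπ0 : 0 < Real.pi := Real.pi_pos
  have hkey : 2 * Real.pi * (|η| * (4 * A / (b * N'))) / M = 8 * Real.pi * (|η| * A / (b * N' * M)) := by
    field_simp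
    ring
  rw [hkey]
  have h1 : |η| * A / (b * N' * M) ≤ (|(ϑ : ℝ)| + |η|) * A / (b * N' * M) := by
    apply div_le_div_of_nonneg_right _ (by positivity)
    exact mul_le_mul_of_nonneg_right (by linarith [abs_nonneg (ϑ : ℝ)]) hA
  have h2 : 0 ≤ |η| * A / (b * N' * M) := by positivity
  nlinarith

/-- **The logarithm against a power**: for `0 < δ`, `1 ≤ y` and `1 ≤ Q ≤ 2y`,
`1 + log Q ≤ (1 + 1/δ) 2^δ y^δ`. [folklore] -/
theorem BC_diag_log_le {δ y Q : ℝ} (hδ : 0 < δ) (hy : 1 ≤ y) (hQ1 : 1 ≤ Q) (hQ : Q ≤ 2 * y) :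
    1 + Real.log Q ≤ (1 + 1 / δ) * (2 : ℝ) ^ δ * y ^ δ := by
  have h2y : (1 : ℝ) ≤ 2 * y := by linarith
  have hlog : Real.log Q ≤ Real.log (2 * y) := Real.log_le_log (by linarith) hQ
  have hlog2 : Real.log (2 * y) ≤ (2 * y) ^ δ / δ := Real.log_le_rpow_div (by linarith) hδ
  have hone : (1 : ℝ) ≤ (2 * y) ^ δ := Real.one_le_rpow h2y hδ.le
  have hmul : (2 * y) ^ δ = (2 : ℝ) ^ δ * y ^ δ := Real.mul_rpow (by norm_num) (by linarith)
  have hpos : 0 ≤ (2 * y) ^ δ := by positivity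
  calc 1 + Real.log Q ≤ (2 * y) ^ δ + (2 * y) ^ δ / δ := by linarith
    _ = (1 + 1 / δ) * (2 * y) ^ δ := by field_simp
    _ = (1 + 1 / δ) * (2 : ℝ) ^ δ * y ^ δ := by rw [hmul]; ring

/-- **`n₂` is determined on the diagonal**: for `R ≥ 0` and `ℓ₂ ≥ 1`,
`∑_{n₂ ∈ T} [ℓ₁n₁ = ℓ₂n₂] R ≤ [ℓ₂ ∣ ℓ₁n₁] R`. [folklore] -/
theorem BC_diag_count_le (T : Finset ℕ) {ℓ₁ n₁ ℓ₂ : ℕ} (hℓ₂ : 0 < ℓ₂) {R : ℝ} (hR : 0 ≤ R) :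
    ∑ n₂ ∈ T, (if ℓ₁ * n₁ = ℓ₂ * n₂ then R else 0) ≤ if ℓ₂ ∣ ℓ₁ * n₁ then R else 0 := by
  classical
  rw [← Finset.sum_filter, Finset.sum_const, nsmul_eq_mul]
  have hcard : (T.filter (fun n₂ => ℓ₁ * n₁ = ℓ₂ * n₂)).card ≤ 1 := by
    refine Finset.card_le_one.mpr fun a ha a' ha' => ?_
    have h1 := (Finset.mem_filter.mp ha).2
    have h2 := (Finset.mem_filter.mp ha').2
    exact Nat.eq_of_mul_eq_mul_left hℓ₂ (h1.symm.trans h2)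
  split_ifs with hdvd
  · calc (((T.filter (fun n₂ => ℓ₁ * n₁ = ℓ₂ * n₂)).card : ℕ) : ℝ) * R ≤ 1 * R := by
          apply mul_le_mul_of_nonneg_right _ hR
          exact_mod_cast hcard
      _ = R := one_mul R
  · have hempty : T.filter (fun n₂ => ℓ₁ * n₁ = ℓ₂ * n₂) = ∅ := by
      refine Finset.filter_eq_empty_iff.mpr fun n₂ _ h => hdvd ⟨n₂, h⟩
    rw [hempty]
    simp

set_option maxHeartbeats 1600000 in
/-- **Bookkeeping for (3.5)**: with `tᵢ ≤ C y^δ` (the divisor functions), `Tw ≤ 26 W` (the twist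
factor), `Lg ≤ (1+1/δ)2^δ y^δ` (the logarithm), `M ≥ 1/2` and `y, C, W ≥ 1`,
`(1+t₁)(2M + t₂² Tw (32(2M+1)A/(bN') + 16 A SQ Lg)) ≤ 13312 C³ (1+1/δ) 2^δ y^{4δ} W (A SQ + AM/(bN') + M)`.
[cite: BettinChandee2018, §3 (3.5)] -/
theorem BC_diag_bookkeeping {M A b N' SQ W Tw Lg t₁ t₂ C y δ : ℝ} (hM : 1 / 2 ≤ M) (hA : 0 ≤ A)
    (hb : 0 < b) (hN' : 0 < N') (hSQ : 0 ≤ SQ) (hW : 1 ≤ W) (hTw0 : 0 ≤ Tw) (hTw : Tw ≤ 26 * W)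
    (hLg0 : 0 ≤ Lg) (hLg : Lg ≤ (1 + 1 / δ) * (2 : ℝ) ^ δ * y ^ δ) (hδ : 0 < δ) (hC : 1 ≤ C)
    (hy : 1 ≤ y) (ht₁ : t₁ ≤ C * y ^ δ) (ht₂0 : 0 ≤ t₂) (ht₂ : t₂ ≤ C * y ^ δ) :
    (1 + t₁) * (2 * M + t₂ ^ 2 * Tw * (32 * (2 * M + 1) * A / (b * N') + 16 * A * SQ * Lg)) ≤
      13312 * C ^ 3 * (1 + 1 / δ) * (2 : ℝ) ^ δ * y ^ (4 * δ) * W *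
        (A * SQ + A * M / (b * N') + M) := by
  -- abbreviations
  set Y : ℝ := y ^ δ with hY
  have hY1 : 1 ≤ Y := by rw [hY]; exact Real.one_le_rpow hy hδ.le
  have hY0 : 0 ≤ Y := by linarith
  set Λ : ℝ := (1 + 1 / δ) * (2 : ℝ) ^ δ with hΛ
  have hΛ1 : 1 ≤ Λ := by
    rw [hΛ]
    have h1 : (1 : ℝ) ≤ 1 + 1 / δ := by
      have : 0 ≤ 1 / δ := by positivity
      linarith
    have h2 : (1 : ℝ) ≤ (2 : ℝ) ^ δ := Real.one_le_rpow (by norm_num) hδ.le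
    nlinarith
  have hΛ0 : 0 ≤ Λ := by linarith
  have hY4 : y ^ (4 * δ) = Y ^ 4 := by
    rw [hY, ← Real.rpow_natCast, ← Real.rpow_mul (by linarith)]
    norm_num
    ring_nf
  rw [hY4]
  have hLg' : Lg ≤ Λ * Y := by rw [hΛ]; linarith only [hLg]
  have hCY1 : 1 ≤ C * Y := one_le_mul_of_one_le_of_one_le hC hY1
  have hCY0 : 0 ≤ C * Y := by linarith only [hCY1]
  have hM0 : 0 < M := by linarith
  have hAM : 0 ≤ A * M / (b * N') := by positivity
  -- the three terms
  set R : ℝ := A * SQ + A * M / (b * N') + M with hR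
  have hR0 : 0 ≤ R := by rw [hR]; positivity
  -- Step 1: `1 + t₁ ≤ 2 C Y`
  have h1 : 1 + t₁ ≤ 2 * (C * Y) := by linarith only [ht₁, hCY1]
  -- Step 2: the inner bracket `≤ 3328 C² Y³ W Λ R`
  have h21 : 32 * (2 * M + 1) * A / (b * N') ≤ 128 * (A * M / (b * N')) := by
    have h4M : 2 * M + 1 ≤ 4 * M := by linarith
    have : 32 * (2 * M + 1) * A / (b * N') = (32 * (2 * M + 1)) * (A / (b * N')) := by ring
    rw [this, show 128 * (A * M / (b * N')) = (128 * M) * (A / (b * N')) by ring]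
    apply mul_le_mul_of_nonneg_right _ (by positivity)
    linarith only [h4M]
  have h22 : 16 * A * SQ * Lg ≤ 16 * (A * SQ) * (Λ * Y) := by
    have : 16 * A * SQ * Lg = 16 * (A * SQ) * Lg := by ring
    rw [this]
    exact mul_le_mul_of_nonneg_left hLg' (by positivity)
  have hbr0 : 0 ≤ 32 * (2 * M + 1) * A / (b * N') + 16 * A * SQ * Lg := by positivity
  have hΛY1 : 1 ≤ Λ * Y := one_le_mul_of_one_le_of_one_le hΛ1 hY1
  have hΛY0 : 0 ≤ Λ * Y := by linarith only [hΛY1]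
  have hASQ : 0 ≤ A * SQ := mul_nonneg hA hSQ
  have h23 : 32 * (2 * M + 1) * A / (b * N') + 16 * A * SQ * Lg ≤ 128 * (Λ * Y) * R := by
    have e1 : 128 * (A * M / (b * N')) ≤ 128 * ((Λ * Y) * (A * M / (b * N'))) := by
      have := mul_le_mul_of_nonneg_right hΛY1 hAM
      linarith only [this]
    have e2 : 16 * (A * SQ) * (Λ * Y) ≤ 128 * ((Λ * Y) * (A * SQ)) := by
      have h0 : 0 ≤ (Λ * Y) * (A * SQ) := mul_nonneg hΛY0 hASQ
      have : 16 * (A * SQ) * (Λ * Y) = 16 * ((Λ * Y) * (A * SQ)) := by ring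
      rw [this]
      linarith only [h0]
    have e3 : 0 ≤ (Λ * Y) * M := mul_nonneg hΛY0 hM0.le
    have hRexp : 128 * (Λ * Y) * R =
        128 * ((Λ * Y) * (A * SQ)) + 128 * ((Λ * Y) * (A * M / (b * N'))) + 128 * ((Λ * Y) * M) := by
      rw [hR]; ring
    rw [hRexp]
    linarith only [h21, h22, e1, e2, e3]
  have h24 : t₂ ^ 2 * Tw ≤ (C * Y) ^ 2 * (26 * W) := by
    have hsq : t₂ ^ 2 ≤ (C * Y) ^ 2 := by
      apply sq_le_sq'
      · linarith
      · exact ht₂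
    exact mul_le_mul hsq hTw hTw0 (by positivity)
  have h25 : t₂ ^ 2 * Tw * (32 * (2 * M + 1) * A / (b * N') + 16 * A * SQ * Lg) ≤
      (C * Y) ^ 2 * (26 * W) * (128 * (Λ * Y) * R) :=
    mul_le_mul h24 h23 hbr0 (by positivity)
  have h26 : 2 * M ≤ (C * Y) ^ 2 * (26 * W) * (128 * (Λ * Y) * R) := by
    -- `2M ≤ 2R ≤ …` since all the other factors are `≥ 1`
    have hMR : M ≤ R := by rw [hR]; linarith only [hASQ, hAM]
    have hbig : (1 : ℝ) ≤ (C * Y) ^ 2 * (26 * W) * (64 * (Λ * Y)) := by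
      have h1' : (1 : ℝ) ≤ (C * Y) ^ 2 := one_le_pow₀ hCY1
      have h2' : (1 : ℝ) ≤ 26 * W := by linarith only [hW]
      have h3' : (1 : ℝ) ≤ 64 * (Λ * Y) := by linarith only [hΛY1]
      calc (1 : ℝ) = 1 * 1 * 1 := by ring
        _ ≤ (C * Y) ^ 2 * (26 * W) * (64 * (Λ * Y)) := by
            apply mul_le_mul (mul_le_mul h1' h2' (by norm_num) (by positivity)) h3' (by norm_num)
              (by positivity)
    calc 2 * M ≤ 2 * R := by linarith only [hMR]
      _ = 1 * (2 * R) := by ring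
      _ ≤ (C * Y) ^ 2 * (26 * W) * (64 * (Λ * Y)) * (2 * R) :=
          mul_le_mul_of_nonneg_right hbig (by positivity)
      _ = (C * Y) ^ 2 * (26 * W) * (128 * (Λ * Y) * R) := by ring
  have h2 : 2 * M + t₂ ^ 2 * Tw * (32 * (2 * M + 1) * A / (b * N') + 16 * A * SQ * Lg) ≤
      2 * ((C * Y) ^ 2 * (26 * W) * (128 * (Λ * Y) * R)) := by linarith only [h25, h26]
  -- Step 3: combine
  have hin0 : 0 ≤ 2 * M + t₂ ^ 2 * Tw * (32 * (2 * M + 1) * A / (b * N') + 16 * A * SQ * Lg) := by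
    positivity
  calc (1 + t₁) * (2 * M + t₂ ^ 2 * Tw * (32 * (2 * M + 1) * A / (b * N') + 16 * A * SQ * Lg))
      ≤ (2 * (C * Y)) * (2 * ((C * Y) ^ 2 * (26 * W) * (128 * (Λ * Y) * R))) :=
        mul_le_mul h1 h2 hin0 (by positivity)
    _ = 13312 * C ^ 3 * Λ * Y ^ 4 * W * R := by ring
    _ = 13312 * C ^ 3 * (1 + 1 / δ) * (2 : ℝ) ^ δ * Y ^ 4 * W * R := by rw [hΛ]; ring

end Literature.NumberTheory.LFunctions

end
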